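import HarnessLib
import HarnessLib.Audit
import Summits.PneNP.PneNP.Theses.PermanentDescent
import Summits.PneNP.PneNP.Theorems.PermanentDescentCollapseMakesPermanentEasyIslandBridge

/-!
# Line `Sketch` (idea `errorless-islands`, v2) — skeleton for the crux `CollapseMakesPermanentEasy` (stmt-PneNP-16142)

Route `PermanentDescent` (route-PneNP-PermanentDescent), crux (rank 2) `CollapseMakesPermanentEasy` =
"NO ALGORITHMICA WITHOUT COUNTICA": `NP ⊆ P → PermBits ∈ P` for the bit-graph language
`PermBits = {⟨s, bin i⟩ : |s| = n², bit i of perm(M_s) over ℕ is 1}` of the 0/1 permanent.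

History (lead prover-line-stmt-PneNP-16142-c1-0, 2026-08-17). v1: seven stubs over the objects of
`Theorems/PermanentDescentCollapseMakesPermanentEasyIslandDefs.lean` (p164002) — `stub_islandDensity` (open,
lead), `stub_bridge` (the seam, lead), and five leaf stubs, ALL FIVE LANDED in wave 1: `stub_hitting`
(p166338, `…IslandHitting.lean`), `stub_interp` (p165711, `…IslandInterp.lean`), `stub_primes` (p165514,
`…IslandPrimes.lean`), `stub_lineFP` (p165698, `…IslandLineFP.lean`), `stub_valFP` (p165904, `…IslandValFP.lean`).
v2 (this file): the seam is PROVED — `Theorems/PermanentDescentCollapseMakesPermanentEasyIslandDecode.lean`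
(part A, p166943), `…IslandRecords.lean` (part B, p166960), `…IslandBridge.lean` (part C: `stub_bridge` as
registered, the unconditional `islandBridge : T ∈ P → SoundIsland T → DenseIsland T → PermBits ∈ P/poly`, and
`collapseMakesPermanentEasy_of_islandDensity`). The skeleton keeps exactly ONE `sorry`: Stub D.

THE BRIDGE (landed, unconditional, relativizing): Lipton 1991's random self-reduction of the permanent in
ERASURE form made NON-UNIFORM — lines `M + cD` through the target with polynomially many advice directions
per prime (averaging + independent repetition + union bound, Stub H), Lagrange interpolation at `0` of the
degree-`≤ n` line polynomial from `n+1` certified = TRUE points (soundness; Stub I), Chinese remaindering over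
all primes in `(n³, 8n³]` (product `≥ 4^{n³}`, Stub N), value tables for the finitely many small sides,
`P/poly = P + poly advice` with the polynomial-time advice-taking decider (Stubs LF, VF).

Stub D is the card's `IslandDensity`: under the collapse some polynomial-time language is a SOUND and DENSE
island of permanent residues. It is collapse-equivalent to the crux — ⇒: this skeleton; ⇐: a P-algorithm for
PermBits gives the permanent of every matrix over `𝔽_p` in polynomial time through Valiant's reduction of
nonnegative-integer permanents to 0/1 permanents (Valiant1979; NOT formalized here — the islands certify
GENERAL residue matrices, as the lines `M + cD` leave the 0/1 matrices), hence the total certifier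
`{⟨p, n, l, permRes p n l⟩}` — an open problem either way; any proof must be NON-RELATIVIZING (Ko1989 Thm 6.4:
the bridge relativizes, so in Ko's world the island density of every P-certifier is negligible).
Disproof used (Disproof.lean, cdisprove c1 @ 2026-08-17T12:56Z): §2 `not_summit_of_not_imp` — Stub D keeps
the collapse as antecedent and is un-killable short of `P = NP`; Targets: none served.
-/

set_option linter.dupNamespace false
set_option linter.unusedVariables false

namespace Summit.PneNP.PneNP.Cruxes.CollapseMakesPermanentEasy.Sketch

open Literature.Computability.Complexity
open Summit.PneNP.PneNP.Theorems.PermIsland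
open Summit.PneNP.PneNP.Theses.PermanentDescent

/-! ## §1 The one remaining registered stub -/

/-- **Stub D (`IslandDensity`; OPEN, LOAD-BEARING, lead-held; size XL).** Under the collapse some
polynomial-time language is a sound and dense island of permanent residues: `SoundIsland T` (it never
certifies a wrong residue of a well-formed query) and `DenseIsland T` (for all large `n` and all primes
`p ∈ (n³, 8n³]` it certifies the true value on `≥ 4(n+1)/p` of `𝔽_p^{n×n}`). Intended witness (card,
solver-checked variant): `T_c = {⟨p, n, M, v⟩ : ∃ π, |π| ≤ c log n, π claims v ∧ no coin sequence makes the
LFKN verifier reject π}` — sound by LFKN alone, in `P` under the collapse; its density is the instance-level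
statement HPA_c ("honest LFKN provers are cheap on a `4(n+1)/p` fraction of matrices"), collapse-equivalent
to the crux. [cite: LFKN1992] [cite: Lipton1991, §3] -/
theorem stub_islandDensity :
    Nondeterministic.NP ⊆ Classes.P →
      ∃ T : Language Bool, T ∈ Classes.P ∧ SoundIsland T ∧ DenseIsland T := by
  sorry

/-! ## §2 The composition (sorry-free modulo Stub D) -/

/-- **THE SKELETON THEOREM.** The crux `Summit.PneNP.PneNP.Theses.PermanentDescent.CollapseMakesPermanentEasy`,
concluded BY NAME: under `h : NP ⊆ P`, Stub D gives a polynomial-time sound dense island, the LANDED bridge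
`Summit.PneNP.PneNP.Theorems.PermIsland.islandBridge` turns it into `PermBits ∈ P/poly`, and the LANDED
uniformization `Summit.PneNP.PneNP.Theorems.uniformizationUnderCollapse_proof` (item stmt-PneNP-16145) into
`PermBits ∈ P`. [folklore] -/
theorem CollapseMakesPermanentEasy_of :
    Summit.PneNP.PneNP.Theses.PermanentDescent.CollapseMakesPermanentEasy := by
  have u := Summit.PneNP.PneNP.Theorems.uniformizationUnderCollapse_proof
  unfold Summit.PneNP.PneNP.Theses.PermanentDescent.UniformizationUnderCollapse at u
  intro h
  obtain ⟨T, hT, hS, hD⟩ := stub_islandDensity h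
  exact u h (islandBridge T hT hS hD)

end Summit.PneNP.PneNP.Cruxes.CollapseMakesPermanentEasy.Sketch
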